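import Summits.AtomisticToContinuum.Crystallization.Theorems.FrustratedLawDichotomyStrainedPatchHomValueT2SlopeSoundA
import Summits.AtomisticToContinuum.Crystallization.Theorems.FrustratedLawDichotomyStrainedPatchHomConvexCurvature

/-!
# (I1) slope part C — the OUTER step of `slopeT2_sound` (`…HomValueT2Track` §14b; critic row 1674 (B) (I1) docket item 3, third instalment;
# 27623 `(H) HomFloor`, hcp half; decomp-a2c hand-1 g49): the `hslope` term is the `y`-space force paired with `Δ`, bounded in `ℓ²`

`Σ_b segG W′ p_b Δ 0 = Σ_a F_a Δ_a` with the `y`-SPACE FORCE `F_a = Σ_b (W′‖p_b‖/‖p_b‖)·(p_b)_a`, hence (Cauchy–Schwarz) componentwise enclosures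
`|F_a| ≤ G_a` give `|Σ_b segG W′ p_b Δ 0| ≤ √(Σ_a G_a²)·‖Δ‖` — the `ℓ²` form of `…HomConvexCurvature.slopeSum_abs_le_of_enclosure` (no `ℓ¹`/`4/3`
loss), i.e. the shape of the `hslope` input of `…HomSignedWell.hcpEnergy_of_ballLeaves_signed` with `G = ‖(G₀, G₁, G₂)‖₂/SC` as `t2SlopeT2` reports it.
No definitions; 0 sorry; standard axioms.  `--supports stmt-AtomisticToContinuum-27623`.
-/

noncomputable section

namespace Summit.AtomisticToContinuum.Crystallization.Theorems.FrustratedLawDichotomyStrainedPatchHomValueT2Kit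

open scoped BigOperators RealInnerProductSpace
open Finset
open Literature.Analysis.ValidatedNumerics.Numerics
open Summit.AtomisticToContinuum.Crystallization.Theorems.FrustratedLawDichotomyStrainedPatchTaylorChord (segG)
open Summit.AtomisticToContinuum.Crystallization.Theorems.FrustratedLawDichotomyStrainedPatchHomConvexCurvature (segG_zero_eq inner_eq_sum3)

/-- The slope sum at the base point is the `y`-space force paired with `Δ`: `Σ_b segG W₁ p_b Δ 0 = Σ_a (Σ_b (W₁‖p_b‖/‖p_b‖)(p_b)_a) Δ_a`.
[formal bookkeeping] -/
theorem slopeSum_eq_force_sum {ι : Type*} (B : Finset ι) (W₁ : ℝ → ℝ) (p : ι → EuclideanSpace ℝ (Fin 3)) (Δ : EuclideanSpace ℝ (Fin 3)) :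
    ∑ b ∈ B, segG W₁ (p b) Δ 0 = ∑ i, (∑ b ∈ B, W₁ ‖p b‖ / ‖p b‖ * p b i) * Δ i := by
  calc ∑ b ∈ B, segG W₁ (p b) Δ 0 = ∑ b ∈ B, ∑ i, W₁ ‖p b‖ / ‖p b‖ * p b i * Δ i := by
        refine Finset.sum_congr rfl fun b _ => ?_
        rw [segG_zero_eq, inner_eq_sum3, Finset.mul_sum]
        exact Finset.sum_congr rfl fun i _ => by ring
    _ = ∑ i, ∑ b ∈ B, W₁ ‖p b‖ / ‖p b‖ * p b i * Δ i := Finset.sum_comm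
    _ = ∑ i, (∑ b ∈ B, W₁ ‖p b‖ / ‖p b‖ * p b i) * Δ i := Finset.sum_congr rfl fun i _ => by rw [Finset.sum_mul]

/-- Cauchy–Schwarz in three coordinates: `|Σ_a g_a Δ_a| ≤ √(Σ_a g_a²)·‖Δ‖`. [folklore] -/
theorem abs_sum_mul_le_sqrt_mul_norm (g : Fin 3 → ℝ) (Δ : EuclideanSpace ℝ (Fin 3)) :
    |∑ i, g i * Δ i| ≤ Real.sqrt (∑ i, g i ^ 2) * ‖Δ‖ := by
  have hCS := Finset.sum_mul_sq_le_sq_mul_sq Finset.univ g (fun i => Δ i)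
  have hΔ : Real.sqrt (∑ i, Δ i ^ 2) = ‖Δ‖ := by
    rw [EuclideanSpace.norm_eq]
    exact congrArg Real.sqrt (Finset.sum_congr rfl fun i _ => by rw [Real.norm_eq_abs, sq_abs])
  have h1 : |∑ i, g i * Δ i| ≤ Real.sqrt (∑ i, g i ^ 2) * Real.sqrt (∑ i, Δ i ^ 2) := by
    rw [← Real.sqrt_mul (Finset.sum_nonneg fun i _ => sq_nonneg (g i)), ← Real.sqrt_sq_eq_abs]
    exact Real.sqrt_le_sqrt hCS
  rwa [hΔ] at h1

/-- ★★ **`ℓ²` SLOPE BOUND FROM COMPONENTWISE FORCE ENCLOSURES**: `|F_a| ≤ G_a` for the three components of the `y`-space force ⟹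
`|Σ_b segG W₁ p_b Δ 0| ≤ √(Σ_a G_a²)·‖Δ‖`. [folklore: Cauchy–Schwarz] -/
theorem slopeSum_abs_le_l2 {ι : Type*} (B : Finset ι) (W₁ : ℝ → ℝ) (p : ι → EuclideanSpace ℝ (Fin 3)) (G : Fin 3 → ℝ)
    (hG : ∀ i, |∑ b ∈ B, W₁ ‖p b‖ / ‖p b‖ * p b i| ≤ G i) (Δ : EuclideanSpace ℝ (Fin 3)) :
    |∑ b ∈ B, segG W₁ (p b) Δ 0| ≤ Real.sqrt (∑ i, G i ^ 2) * ‖Δ‖ := by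
  rw [slopeSum_eq_force_sum]
  refine (abs_sum_mul_le_sqrt_mul_norm _ Δ).trans (mul_le_mul_of_nonneg_right (Real.sqrt_le_sqrt ?_) (norm_nonneg _))
  exact Finset.sum_le_sum fun i _ => sq_le_sq' (abs_le.1 (hG i)).1 (abs_le.1 (hG i)).2

/-- The kit's units: componentwise `|F_a|·SC ≤ G_a` (integers `G_a`, as `t2SlopeT2` certifies) ⟹ `|Σ_b segG W₁ p_b Δ 0| ≤ (√(Σ_a G_a²)/SC)·‖Δ‖`.
[arithmetic] -/
theorem slopeSum_abs_le_l2_SC {ι : Type*} (B : Finset ι) (W₁ : ℝ → ℝ) (p : ι → EuclideanSpace ℝ (Fin 3)) (G : Fin 3 → ℤ)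
    (hG : ∀ i, |∑ b ∈ B, W₁ ‖p b‖ / ‖p b‖ * p b i| * SC ≤ (G i : ℝ)) (Δ : EuclideanSpace ℝ (Fin 3)) :
    |∑ b ∈ B, segG W₁ (p b) Δ 0| ≤ Real.sqrt (∑ i, ((G i : ℤ) : ℝ) ^ 2) / SC * ‖Δ‖ := by
  have hS := SC_pos
  have h := slopeSum_abs_le_l2 B W₁ p (fun i => (G i : ℝ) / SC) (fun i => by rw [le_div_iff₀ hS]; exact hG i) Δ
  have e : Real.sqrt (∑ i, ((G i : ℝ) / SC) ^ 2) = Real.sqrt (∑ i, ((G i : ℤ) : ℝ) ^ 2) / SC := by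
    rw [← Real.sqrt_sq hS.le, ← Real.sqrt_div' _ (sq_nonneg _), Real.sqrt_sq hS.le, Finset.sum_div]
    exact congrArg Real.sqrt (Finset.sum_congr rfl fun i _ => by rw [div_pow])
  rwa [e] at h

end Summit.AtomisticToContinuum.Crystallization.Theorems.FrustratedLawDichotomyStrainedPatchHomValueT2Kit
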